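import Literature.Probability.LatticeModels.FejerKernel
import Literature.Probability.LatticeModels.TorusFourierProofs
import Mathlib.Analysis.SpecialFunctions.Trigonometric.Bounds
import Mathlib.Analysis.Real.Pi.Bounds
import HarnessLib

/-!
# The box kernel on the discrete torus: Dirichlet factorisation, tail decay, and the LOWER bound at
# small momenta

Topic `Probability/LatticeModels`, companion of `FejerKernel.lean` (`dirichletSum R u = Σ_{n<R} e^{inu}`,
`fejerKernel`, `norm_dirichletSum_eq`, `fejerKernel_le_div_sq`) and `TorusFourierProofs.lean`
(characters `torusChar` of `(ℤ/Lℤ)^d`). The BOX KERNEL of side `R` on the torus of side `L`,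
`F_R(m) = Σ_{u ∈ [0,R)^d} χ_m(u)` (written literally, offsets `i ↦ ((u i : ℕ) : ZMod L)`), is the
Fourier multiplier of block (box) averages; `|F_R(m)|²` is the separable Fejér weight of the
Fejér-box / block functionals of the `HubbardSuperconductivity` routes (tent identity
`Σ_a ‖B_a ψ‖² = R² T_R(ψ)`, block Plancherel `L² Σ_a B_aᴴB_a = Σ_m |F_R(m)|² Δ(m)ᴴΔ(m)` of
`MathematicalPhysics/QuantumLattice/BlockPairPlancherel.lean`). Proved here (no definitions):

* `norm_dirichletSum_ge` — **lower bound of the Dirichlet sum on its main lobe**: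
  `R|u| ≤ π ⇒ ‖D_R(u)‖ ≥ 2R/π` (closed form `|sin(Ru/2)|/|sin(u/2)|`, Jordan's inequality above,
  `|sin x| ≤ |x|` below);
* `sum_stdAddChar_mul_natCast_eq_dirichletSum`, `boxKernel_eq_prod_dirichletSum` — the box kernel
  factorises into Dirichlet sums at the Brillouin-zone momenta `uᵢ = 2π · valMinAbs(mᵢ)/L ∈ (-π, π]`:
  `F_R(m) = Πᵢ D_R(uᵢ)`;
* `norm_boxKernel_le` (`‖F_R(m)‖ ≤ R^d`), `boxKernel_zero` (`F_R(0) = R^d`),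
  `norm_dirichletSum_sq_mul_sq_le` (`‖D_R(uᵢ)‖² uᵢ² ≤ π²`) and, in `d = 2`,
  `norm_boxKernel_sq_mul_le` — the TAIL bound `‖F_R(m)‖² |q_m|² ≤ 2π² R²`
  (`|q_m|² = (2π/L)² Σᵢ valMinAbs(mᵢ)²`), i.e. `|F_R(m)|²/R⁴ ≤ 2π²/(R|q_m|)²` off the main lobe;
* `norm_boxKernel_sq_ge` — the MAIN-LOBE bound, `d = 2`: **`R²|q_m|² ≤ π² ⇒ ‖F_R(m)‖² ≥ 16R⁴/π⁴`**.
  With the tail bound this brackets the Fejér weight: `|F_R|²/R⁴ ∈ [16/π⁴, 1]` on `|q| ≤ π/R` and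
  `≤ 2π²/(R|q|)²` beyond — the box functional at scale `R` is, up to constants, the pair (or spin)
  structure factor summed over the momentum ball of radius `π/R` (consumer:
  `Summits/…/FunctionFieldCertificateMesoscopicPairOrderInfraredWeight.lean`, the equivalence of the
  crux `MesoscopicPairOrder` with a uniform infrared pair-weight floor).

Sources: E. M. Stein, R. Shakarchi, *Fourier Analysis* (2003), Ch. 2 §5 and Ch. 7 §1 (Dirichlet and
Fejér kernels, finite Fourier analysis); A. Zygmund, *Trigonometric Series* I (2002), Ch. II §6
(`|D_n(u)| ≍ n` for `|u| ≲ 1/n`); S. Friedli, Y. Velenik, *Statistical Mechanics of Lattice Systems*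
(2017), §10.4. Folklore statements.

## Mathlib / tree search

Tree: `dirichletSum`, `fejerKernel`, `dirichletSum_eq_geom`, `norm_dirichletSum_le`,
`norm_dirichletSum_eq`, `fejerKernel_le_div_sq` (`FejerKernel`); `torusChar` (`TorusFourierProofs`);
the Summits file `WeakCouplingBCSWcbcsSsbToTorusLROFejerClosure.lean` proves the factorisation and
the tail bound PRIVATELY (re-proved here publicly; the lower bound is new). Mathlib:
`ZMod.stdAddChar_coe`, `ZMod.coe_valMinAbs`, `ZMod.valMinAbs_mem_Ioc`, `AddChar.map_nsmul_eq_pow`,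
`Real.mul_abs_le_abs_sin`, `Real.abs_sin_le_abs`, `Real.sin_eq_zero_iff_of_lt_of_lt`,
`Fintype.prod_sum`.
-/

noncomputable section

namespace Literature.Probability.LatticeModels

open Finset Complex
open scoped ComplexConjugate

/-! ### The Dirichlet sum on its main lobe -/

/-- `D_R(0) = R`. [folklore] -/
theorem dirichletSum_zero (R : ℕ) : dirichletSum R 0 = R := by
  unfold dirichletSum
  simp

/-- **Lower bound of the Dirichlet sum on its main lobe**: if `R|u| ≤ π` then
`2R/π ≤ ‖D_R(u)‖` (`‖D_R(u)‖ = |sin(Ru/2)|/|sin(u/2)|`, `|sin(Ru/2)| ≥ (2/π)(R|u|/2)` by Jordan's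
inequality since `R|u|/2 ≤ π/2`, and `|sin(u/2)| ≤ |u|/2`). Zygmund, *Trigonometric Series* I,
Ch. II §6; Stein–Shakarchi, *Fourier Analysis*, Ch. 2. [folklore] -/
theorem norm_dirichletSum_ge {R : ℕ} {u : ℝ} (hu : (R : ℝ) * |u| ≤ Real.pi) :
    2 * (R : ℝ) / Real.pi ≤ ‖dirichletSum R u‖ := by
  have hπ : 0 < Real.pi := Real.pi_pos
  rcases Nat.eq_zero_or_pos R with rfl | hR
  · simp
  have hR' : (1 : ℝ) ≤ R := by exact_mod_cast hR
  by_cases hu0 : u = 0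
  · subst hu0
    rw [dirichletSum_zero, Complex.norm_natCast, div_le_iff₀ hπ]
    nlinarith [Real.pi_gt_three]
  -- `|u| ≤ π/R ≤ π`, so `sin(u/2) ≠ 0`
  have hule : |u| ≤ Real.pi := by
    have : |u| ≤ (R : ℝ) * |u| := le_mul_of_one_le_left (abs_nonneg u) hR'
    linarith
  have hs0 : Real.sin (u / 2) ≠ 0 := by
    intro h
    have h1 : -Real.pi < u / 2 := by
      have := neg_abs_le u
      linarith
    have h2 : u / 2 < Real.pi := by
      have := le_abs_self u
      linarith
    have := (Real.sin_eq_zero_iff_of_lt_of_lt h1 h2).1 h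
    exact hu0 (by linarith)
  rw [norm_dirichletSum_eq hs0, le_div_iff₀ (abs_pos.2 hs0)]
  -- Jordan above, `|sin x| ≤ |x|` below
  have hx : |(R : ℝ) * u / 2| ≤ Real.pi / 2 := by
    rw [abs_div, abs_mul, abs_two, Nat.abs_cast]
    linarith
  have hj := Real.mul_abs_le_abs_sin hx
  rw [abs_div, abs_mul, abs_two, Nat.abs_cast] at hj
  have hk : |Real.sin (u / 2)| ≤ |u| / 2 := by
    have := Real.abs_sin_le_abs (x := u / 2)
    rwa [abs_div, abs_two] at this
  calc 2 * (R : ℝ) / Real.pi * |Real.sin (u / 2)|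
      ≤ 2 * (R : ℝ) / Real.pi * (|u| / 2) := mul_le_mul_of_nonneg_left hk (by positivity)
    _ = 2 / Real.pi * ((R : ℝ) * |u| / 2) := by ring
    _ ≤ |Real.sin ((R : ℝ) * u / 2)| := hj

/-- **Tail bound for one Dirichlet factor**: `‖D_R(u)‖² · u² ≤ π²` for `|u| ≤ π` (the decay
`fejerKernel_le_div_sq` of the Fejér kernel `‖D_R‖²/R`). Stein–Shakarchi, Ch. 2. [folklore] -/
theorem norm_dirichletSum_sq_mul_sq_le (R : ℕ) {u : ℝ} (hu : |u| ≤ Real.pi) :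
    ‖dirichletSum R u‖ ^ 2 * u ^ 2 ≤ Real.pi ^ 2 := by
  rcases Nat.eq_zero_or_pos R with rfl | hR
  · simp [dirichletSum]; positivity
  by_cases hu0 : u = 0
  · subst hu0; simp; positivity
  have hR' : (0 : ℝ) < R := by exact_mod_cast hR
  have h := fejerKernel_le_div_sq (L := R) hR hu0 hu
  unfold fejerKernel at h
  rw [div_le_div_iff₀ hR' (by positivity)] at h
  -- `‖D‖² · (R u²) ≤ π² · R`
  have hu2 : 0 < u ^ 2 := by positivity
  nlinarith

/-! ### The box kernel on the torus factorises into Dirichlet sums -/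

section Torus

variable {d L : ℕ} [NeZero L]

/-- The character sum over an initial segment is a Dirichlet sum at the Brillouin-zone momentum:
`Σ_{v<R} e(k v) = D_R(2π · valMinAbs(k)/L)` (`e(k) = e^{2πi valMinAbs(k)/L}`). [folklore] -/
theorem sum_stdAddChar_mul_natCast_eq_dirichletSum (k : ZMod L) (R : ℕ) :
    ∑ v : Fin R, (ZMod.stdAddChar (k * ((v : ℕ) : ZMod L)) : ℂ) =
      dirichletSum R (2 * Real.pi * ((k.valMinAbs : ℤ) : ℝ) / L) := by
  have hω : (ZMod.stdAddChar k : ℂ) =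
      Complex.exp (((2 * Real.pi * ((k.valMinAbs : ℤ) : ℝ) / L : ℝ) : ℂ) * Complex.I) := by
    have h := ZMod.stdAddChar_coe (N := L) k.valMinAbs
    rw [ZMod.coe_valMinAbs] at h
    rw [h]
    congr 1
    push_cast
    ring
  rw [dirichletSum_eq_geom, Finset.sum_range]
  refine Finset.sum_congr rfl fun v _ => ?_
  rw [← hω, ← AddChar.map_nsmul_eq_pow, nsmul_eq_mul, mul_comm]

/-- **The box kernel factorises**: `F_R(m) = Σ_{u ∈ [0,R)^d} χ_m(u) = Πᵢ D_R(2π valMinAbs(mᵢ)/L)`.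
Friedli–Velenik (2017) §10.4. [folklore] -/
theorem boxKernel_eq_prod_dirichletSum (m : TorusSite d L) (R : ℕ) :
    ∑ u : Fin d → Fin R, torusChar m (fun i => ((u i : ℕ) : ZMod L)) =
      ∏ i, dirichletSum R (2 * Real.pi * (((m i).valMinAbs : ℤ) : ℝ) / L) := by
  simp_rw [← sum_stdAddChar_mul_natCast_eq_dirichletSum]
  rw [Fintype.prod_sum]
  rfl

/-- `‖F_R(m)‖ ≤ R^d`. [folklore] -/
theorem norm_boxKernel_le (m : TorusSite d L) (R : ℕ) :
    ‖∑ u : Fin d → Fin R, torusChar m (fun i => ((u i : ℕ) : ZMod L))‖ ≤ (R : ℝ) ^ d := by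
  refine (norm_sum_le _ _).trans ?_
  simp

/-- `F_R(0) = R^d`. [folklore] -/
theorem boxKernel_zero (R : ℕ) :
    ∑ u : Fin d → Fin R, torusChar (0 : TorusSite d L) (fun i => ((u i : ℕ) : ZMod L)) =
      (R : ℂ) ^ d := by
  simp

/-- The Brillouin-zone momentum `2π valMinAbs(k)/L` lies in `[-π, π]`. [folklore] -/
theorem abs_brillouin_le_pi (k : ZMod L) :
    |2 * Real.pi * ((k.valMinAbs : ℤ) : ℝ) / L| ≤ Real.pi := by
  have hL : (0 : ℝ) < L := Nat.cast_pos.2 (Nat.pos_of_ne_zero (NeZero.ne L))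
  have hn : |((k.valMinAbs : ℤ) : ℝ)| ≤ L / 2 := by
    have h := ZMod.valMinAbs_mem_Ioc k
    rw [Set.mem_Ioc] at h
    have h1 : ((-(L : ℕ) : ℤ) : ℝ) < ((k.valMinAbs * 2 : ℤ) : ℝ) := by exact_mod_cast h.1
    have h2 : ((k.valMinAbs * 2 : ℤ) : ℝ) ≤ ((L : ℕ) : ℤ) := by exact_mod_cast h.2
    push_cast at h1 h2
    rw [abs_le]
    constructor <;> linarith
  rw [abs_div, abs_mul, abs_mul, abs_two, abs_of_pos Real.pi_pos, Nat.abs_cast, div_le_iff₀ hL]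
  nlinarith [Real.pi_pos]

/-- **Tail bound** (`d = 2`): `‖F_R(m)‖² · |q_m|² ≤ 2π² R²` with `|q_m|² = (2π/L)² Σᵢ valMinAbs(mᵢ)²`
— the one-dimensional tail bound in the coordinate carrying the momentum and `‖D_R‖ ≤ R` in the other.
So off the main lobe `|F_R(m)|²/R⁴ ≤ 2π²/(R |q_m|)²`. Stein–Shakarchi, Ch. 2. [folklore] -/
theorem norm_boxKernel_sq_mul_le (m : TorusSite 2 L) (R : ℕ) :
    ‖∑ u : Fin 2 → Fin R, torusChar m (fun i => ((u i : ℕ) : ZMod L))‖ ^ 2 *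
        ((2 * Real.pi / L) ^ 2 * ∑ i, (((m i).valMinAbs : ℤ) : ℝ) ^ 2) ≤
      2 * Real.pi ^ 2 * (R : ℝ) ^ 2 := by
  rw [boxKernel_eq_prod_dirichletSum, norm_prod, Fin.prod_univ_two, Fin.sum_univ_two]
  set u0 : ℝ := 2 * Real.pi * (((m 0).valMinAbs : ℤ) : ℝ) / L with hu0
  set u1 : ℝ := 2 * Real.pi * (((m 1).valMinAbs : ℤ) : ℝ) / L with hu1
  have h0 := norm_dirichletSum_le R u0
  have h1 := norm_dirichletSum_le R u1
  have k0 := norm_dirichletSum_sq_mul_sq_le R (abs_brillouin_le_pi (L := L) (m 0))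
  have k1 := norm_dirichletSum_sq_mul_sq_le R (abs_brillouin_le_pi (L := L) (m 1))
  rw [← hu0] at k0
  rw [← hu1] at k1
  set G0 := ‖dirichletSum R u0‖
  set G1 := ‖dirichletSum R u1‖
  have hG0 : G0 ^ 2 ≤ (R : ℝ) ^ 2 := pow_le_pow_left₀ (norm_nonneg _) h0 2
  have hG1 : G1 ^ 2 ≤ (R : ℝ) ^ 2 := pow_le_pow_left₀ (norm_nonneg _) h1 2
  have hq : (2 * Real.pi / L) ^ 2 * ((((m 0).valMinAbs : ℤ) : ℝ) ^ 2 + (((m 1).valMinAbs : ℤ) : ℝ) ^ 2) =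
      u0 ^ 2 + u1 ^ 2 := by
    rw [hu0, hu1]; ring
  rw [hq]
  calc (G0 * G1) ^ 2 * (u0 ^ 2 + u1 ^ 2)
      = G1 ^ 2 * (G0 ^ 2 * u0 ^ 2) + G0 ^ 2 * (G1 ^ 2 * u1 ^ 2) := by ring
    _ ≤ (R : ℝ) ^ 2 * Real.pi ^ 2 + (R : ℝ) ^ 2 * Real.pi ^ 2 :=
        add_le_add (mul_le_mul hG1 k0 (by positivity) (by positivity))
          (mul_le_mul hG0 k1 (by positivity) (by positivity))
    _ = 2 * Real.pi ^ 2 * (R : ℝ) ^ 2 := by ring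

/-- **Main-lobe lower bound** (`d = 2`): if `R² |q_m|² ≤ π²` (`|q_m|² = (2π/L)² Σᵢ valMinAbs(mᵢ)²`,
i.e. `|q_m| ≤ π/R`) then `‖F_R(m)‖² ≥ 16 R⁴/π⁴` — each coordinate has `R|uᵢ| ≤ π`, so each Dirichlet
factor is `≥ 2R/π`. Hence on the momentum ball of radius `π/R` the normalised Fejér weight
`|F_R(m)|²/R⁴` is pinched in `[16/π⁴, 1]`. Zygmund, *Trigonometric Series* I, Ch. II §6. [folklore] -/
theorem norm_boxKernel_sq_ge (m : TorusSite 2 L) (R : ℕ)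
    (hm : (R : ℝ) ^ 2 * ((2 * Real.pi / L) ^ 2 * ∑ i, (((m i).valMinAbs : ℤ) : ℝ) ^ 2) ≤
      Real.pi ^ 2) :
    16 * (R : ℝ) ^ 4 / Real.pi ^ 4 ≤
      ‖∑ u : Fin 2 → Fin R, torusChar m (fun i => ((u i : ℕ) : ZMod L))‖ ^ 2 := by
  have hπ : 0 < Real.pi := Real.pi_pos
  rw [boxKernel_eq_prod_dirichletSum, norm_prod, Fin.prod_univ_two]
  rw [Fin.sum_univ_two] at hm
  set u0 : ℝ := 2 * Real.pi * (((m 0).valMinAbs : ℤ) : ℝ) / L with hu0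
  set u1 : ℝ := 2 * Real.pi * (((m 1).valMinAbs : ℤ) : ℝ) / L with hu1
  have hq : (2 * Real.pi / L) ^ 2 * ((((m 0).valMinAbs : ℤ) : ℝ) ^ 2 + (((m 1).valMinAbs : ℤ) : ℝ) ^ 2) =
      u0 ^ 2 + u1 ^ 2 := by
    rw [hu0, hu1]; ring
  rw [hq] at hm
  -- each coordinate: `(R |uᵢ|)² ≤ π²`, hence `R|uᵢ| ≤ π`
  have hc : ∀ u : ℝ, (R : ℝ) ^ 2 * u ^ 2 ≤ Real.pi ^ 2 → (R : ℝ) * |u| ≤ Real.pi := by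
    intro u h
    have h' : ((R : ℝ) * |u|) ^ 2 ≤ Real.pi ^ 2 := by rw [mul_pow, sq_abs]; exact h
    exact (pow_le_pow_iff_left₀ (by positivity) hπ.le two_ne_zero).1 h'
  have h0 : (R : ℝ) * |u0| ≤ Real.pi := hc u0 (by nlinarith [sq_nonneg u1, sq_nonneg (R : ℝ)])
  have h1 : (R : ℝ) * |u1| ≤ Real.pi := hc u1 (by nlinarith [sq_nonneg u0, sq_nonneg (R : ℝ)])
  have g0 := norm_dirichletSum_ge h0
  have g1 := norm_dirichletSum_ge h1
  have hnn : 0 ≤ 2 * (R : ℝ) / Real.pi := by positivity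
  have hprod : (2 * (R : ℝ) / Real.pi) * (2 * (R : ℝ) / Real.pi) ≤
      ‖dirichletSum R u0‖ * ‖dirichletSum R u1‖ := mul_le_mul g0 g1 hnn (norm_nonneg _)
  have hsq := pow_le_pow_left₀ (by positivity) hprod 2
  calc 16 * (R : ℝ) ^ 4 / Real.pi ^ 4 = ((2 * (R : ℝ) / Real.pi) * (2 * (R : ℝ) / Real.pi)) ^ 2 := by
        field_simp
        ring
    _ ≤ (‖dirichletSum R u0‖ * ‖dirichletSum R u1‖) ^ 2 := hsq

end Torus

end Literature.Probability.LatticeModels
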